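import Literature.NumberTheory.Automorphic.LinearAlgebraicGroups
import HarnessLib

/-!
# Discharges of the named facts of `LinearAlgebraicGroups` (characters of `𝔾ₘ`; the torus `𝔻ₙ`)

Sibling proof file of `Literature.NumberTheory.Automorphic.LinearAlgebraicGroups` (namespace
`Literature.Automorphic`). It proves, sorry-free, the named facts (section `PairingHolds`)

* `exists_unique_charPairing` : over an infinite field `k`, for an algebraic character
  `χ : T → kˣ` and an algebraic cocharacter `λ : kˣ → T` of a subgroup `T ≤ GL n k`, the composite
  `χ ∘ λ : kˣ → kˣ` is `x ↦ x ^ m` for a unique integer `m = ⟨χ, λ⟩`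
  (as `exists_unique_charPairing_holds`);
* `charPairingInt_spec` : `χ (λ x) = x ^ ⟨χ, λ⟩` for the tree's `charPairingInt`
  (as `charPairingInt_spec_holds`).

Springer, *Linear Algebraic Groups* (2nd ed.), 3.2.2 (with `n = 1`) and the paragraph preceding
Lemma 3.2.11, obtains the integer `⟨χ, λ⟩` with `χ(λ(a)) = a ^ ⟨χ, λ⟩` from Dedekind's theorem
(linear independence of characters, 3.2.1): a character of `𝔾ₘ = 𝔻₁` lies in
`k[𝔻₁] = k[T, T⁻¹]`, whose basis of monomials `T ^ a` (`a ∈ ℤ`) consists of characters, so it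
*is* one of them; `X*(𝔻₁) ≅ ℤ`. The proof below is the coefficientwise form of that argument and
needs only `k` infinite (Springer works over an algebraically closed field):

* `exists_pow_mul_eval_eq_polynomial_eval` : clearing denominators, a Laurent polynomial
  `Q(x, x⁻¹)` is `f(x) / x ^ N` on `kˣ` with `f ∈ k[X]`;
* `polynomial_eval_eq_pow_natDegree_of_map_mul` : if `f ≠ 0` is multiplicative on `kˣ` then
  `f(y) = y ^ deg f` for `y ≠ 0` — the identity `f(y X) = f(y) f(X)` holds on the infinite set
  `kˣ`, hence in `k[X]` (`Polynomial.eq_zero_of_infinite_isRoot`); compare top coefficients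
  (`Polynomial.comp_C_mul_X_coeff`);
* `zpowGroupHom_units_injective` : the characters `x ↦ x ^ m` of `kˣ` are pairwise distinct
  (`X ^ e - 1`, `e > 0`, has finitely many roots), i.e. `X*(𝔾ₘ) ≅ ℤ`.

and (section `IsTorusSubgroupDiagonalHolds`) the named fact

* `isTorusSubgroup_diagonal` : over an algebraically closed field `k` the diagonal subgroup
  `diagonalSubgroup n k = 𝔻ₙ ≤ GL n k` satisfies `IsTorusSubgroup`, i.e. it is Zariski-closed with
  no proper Zariski-closed subgroup of finite index (`IsZConnected`), commutative, and consists of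
  semisimple elements (as `isTorusSubgroup_diagonal_holds`), via

* `isAlgebraicSubgroup_diagonalSubgroup` : `𝔻ₙ` is the zero locus of the coordinates `x i j`,
  `i ≠ j` (Springer 2.1.4 (4)(b)); a matrix of `GL n k` with vanishing off-diagonal entries has unit
  diagonal entries since `det = ∏ x i i ≠ 0`;
* `eq_diagonalSubgroup_of_finiteIndex` : over an algebraically closed field `𝔻ₙ ≅ (kˣ)ⁿ` has no
  proper subgroup of finite index at all — the group of points is divisible (`m`-th roots exist,
  `IsAlgClosed.exists_pow_nat_eq`) while `g ^ m` lies in any normal subgroup of index `m`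
  (`Subgroup.pow_index_mem` for the normal core). This is the group-of-points form of the
  connectedness of `𝔻ₙ` (Springer 2.2.1 (iii): a closed subgroup of finite index contains `G⁰`;
  2.2.2 (1): `𝔻ₙ` is connected);
* `isMulCommutative_diagonalSubgroup` : `𝔻ₙ` is the image of the commutative group `(kˣ)ⁿ`;
* `isSemisimpleElt_diagonalGL` : a diagonal matrix with entries `d i` is killed by the separable,
  hence squarefree, polynomial `∏_{c ∈ {d i}} (X - c)`, so it is semisimple
  (`Module.End.isSemisimple_of_squarefree_aeval_eq_zero`; Springer 2.4.1–2.4.2).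

Springer 3.2.1 *defines* a torus as a linear algebraic group isomorphic to some `𝔻ₙ`, and 3.2.7 (ii)
shows a diagonalizable group is a torus iff it is connected; the fact discharged here is that `𝔻ₙ`
itself has the three defining properties of `IsTorusSubgroup` (the file's points-over-`k` rendering
of "connected, commutative, semisimple elements", faithful for `k` algebraically closed).
Only the connectedness clause uses `IsAlgClosed k`.

## References

* T. A. Springer, *Linear Algebraic Groups*, 2nd ed., Progress in Math. 9, Birkhäuser (1998)
  [SpringerLAG1998]: 3.2.1 (characters, cocharacters, Dedekind), 3.2.2 (`X*(𝔻ₙ) ≅ ℤⁿ`, every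
  character of `𝔻ₙ` is a monomial), paragraph before 3.2.11 and Lemma 3.2.11 (i) (the pairing
  `⟨χ, λ⟩`); for the torus section also 2.1.4 (4)(b) (`𝔻ₙ` closed in `GLₙ`), 2.2.1 (i), (iii)
  (identity component; closed finite-index subgroups contain `G⁰`), 2.2.2 (1) (`𝔻ₙ` connected),
  2.4.1–2.4.2 (semisimple elements), 3.2.1 (definition of a torus), 3.2.7 (ii).
-/

open scoped IsMulCommutative

namespace Literature.NumberTheory.Automorphic

variable {k : Type*} [Field k] {n : Type*} [Fintype n] [DecidableEq n]

section PairingHolds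

open Polynomial in
/-- A polynomial in `x` and `x⁻¹` becomes a polynomial in `x` after multiplication by a power of
`x`: for `Q ∈ k[X₀, X₁]` there are `N` and `f ∈ k[X]` with `x ^ N · Q(x, x⁻¹) = f(x)` for all
`x ∈ kˣ` (`k[T, T⁻¹] = ⋃ T⁻ᴺ k[T]`, Springer 3.2.2 with `n = 1`). [folklore] -/
theorem exists_pow_mul_eval_eq_polynomial_eval (Q : MvPolynomial (Fin 2) k) :
    ∃ (N : ℕ) (f : k[X]), ∀ x : kˣ,
      (x : k) ^ N * MvPolynomial.eval ![(x : k), (x⁻¹ : kˣ)] Q = f.eval (x : k) := by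
  induction Q using MvPolynomial.induction_on with
  | C a => exact ⟨0, Polynomial.C a, fun x => by simp⟩
  | add p q hp hq =>
    obtain ⟨M, f, hf⟩ := hp
    obtain ⟨N, g, hg⟩ := hq
    refine ⟨M + N, X ^ N * f + X ^ M * g, fun x => ?_⟩
    rw [map_add, mul_add, eval_add, eval_mul, eval_mul, eval_pow, eval_pow, eval_X, ← hf, ← hg]
    ring
  | mul_X p i hp =>
    obtain ⟨M, f, hf⟩ := hp
    fin_cases i
    · refine ⟨M, f * X, fun x => ?_⟩
      rw [map_mul, MvPolynomial.eval_X, eval_mul, eval_X, ← hf]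
      simp only [Fin.zero_eta, Fin.isValue, Matrix.cons_val_zero]
      ring
    · refine ⟨M + 1, f, fun x => ?_⟩
      rw [map_mul, MvPolynomial.eval_X, ← hf]
      simp only [Fin.mk_one, Fin.isValue, Matrix.cons_val_one, Matrix.cons_val_fin_one,
        Units.val_inv_eq_inv_val]
      rw [pow_succ]
      field_simp

/-- Over an infinite field the characters `x ↦ x ^ m` (`m ∈ ℤ`) of `kˣ` are pairwise distinct:
if `x ^ e = 1` for all `x ∈ kˣ` with `e ≠ 0` then `X ^ |e| - 1` would have infinitely many roots
(Springer 3.2.2: `X*(𝔾ₘ) ≅ ℤ`). [folklore] -/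
theorem zpowGroupHom_units_injective [Infinite k] :
    Function.Injective fun m : ℤ => (zpowGroupHom m : kˣ →* kˣ) := by
  intro m m' h
  by_contra hne
  have h1 : ∀ x : kˣ, x ^ (m - m') = 1 := fun x => by
    have hx := DFunLike.congr_fun h x
    simp only [zpowGroupHom_apply] at hx
    rw [zpow_sub, hx, mul_inv_cancel]
  have he0 : 0 < (m - m').natAbs := Int.natAbs_pos.mpr (sub_ne_zero.mpr hne)
  have h2 : ∀ x : kˣ, (x : k) ^ (m - m').natAbs = 1 := fun x => by
    rw [← Units.val_pow_eq_pow_val, pow_natAbs_eq_one.mpr (h1 x), Units.val_one]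
  refine Polynomial.X_pow_sub_C_ne_zero he0 (1 : k)
    (Polynomial.eq_zero_of_infinite_isRoot _ ?_)
  refine Set.Infinite.mono ?_ ((Set.finite_singleton (0 : k)).infinite_compl)
  intro x hx
  have hx0 : x ≠ 0 := hx
  simp only [Set.mem_setOf_eq, Polynomial.IsRoot.def, Polynomial.eval_sub, Polynomial.eval_pow,
    Polynomial.eval_X, Polynomial.eval_C, sub_eq_zero]
  have := h2 (Units.mk0 x hx0)
  rwa [Units.val_mk0] at this

/-- A polynomial `f ∈ k[X]` over an infinite field which is multiplicative on `kˣ`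
(`f(xy) = f(x) f(y)` for `x, y ≠ 0`) and non-zero is the monomial `X ^ deg f` on `kˣ`
(coefficientwise form of Dedekind's argument, Springer 3.2.2). [folklore] -/
theorem polynomial_eval_eq_pow_natDegree_of_map_mul [Infinite k] {f : Polynomial k} (hf0 : f ≠ 0)
    (hmul : ∀ x y : kˣ, f.eval ((x : k) * y) = f.eval (x : k) * f.eval (y : k)) (y : kˣ) :
    f.eval (y : k) = (y : k) ^ f.natDegree := by
  -- `f (y x) = f y · f x` as polynomials in `x`
  have hcomp : f.comp (Polynomial.C (y : k) * Polynomial.X) =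
      Polynomial.C (f.eval (y : k)) * f := by
    rw [← sub_eq_zero]
    apply Polynomial.eq_zero_of_infinite_isRoot
    refine Set.Infinite.mono ?_ ((Set.finite_singleton (0 : k)).infinite_compl)
    intro x hx
    have hx0 : x ≠ 0 := hx
    simp only [Set.mem_setOf_eq, Polynomial.IsRoot.def, Polynomial.eval_sub, Polynomial.eval_comp,
      Polynomial.eval_mul, Polynomial.eval_C, Polynomial.eval_X]
    have := hmul y (Units.mk0 x hx0)
    rw [Units.val_mk0] at this
    rw [this, sub_self]
  have hlead : f.coeff f.natDegree ≠ 0 := Polynomial.leadingCoeff_ne_zero.mpr hf0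
  have hd := congrArg (fun q => Polynomial.coeff q f.natDegree) hcomp
  simp only [Polynomial.comp_C_mul_X_coeff, Polynomial.coeff_C_mul] at hd
  exact (mul_left_cancel₀ hlead (hd.trans (mul_comm _ _))).symm

variable {T : Subgroup (GL n k)}

/-- **Discharge** of `exists_unique_charPairing` (Springer, *Linear Algebraic Groups*, 3.2.2 with
`n = 1` and the paragraph preceding Lemma 3.2.11: for `χ ∈ X*(T)`, `λ ∈ X_*(T)` the map
`a ↦ χ(λ(a))` is a character of `𝔾ₘ`, hence `a ↦ a ^ ⟨χ, λ⟩` for a unique integer). Proof: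
`χ(λ(x)) = Q(x, x⁻¹)` is a Laurent polynomial (`eval_bind₁`), `x ^ N Q(x, x⁻¹) = f(x)` with
`f ∈ k[X]` multiplicative on `kˣ` (`exists_pow_mul_eval_eq_polynomial_eval`), so `f(x) = x ^ d`
on the infinite set `kˣ` (`polynomial_eval_eq_pow_natDegree_of_map_mul`) and
`χ ∘ λ = (· ^ (d - N))`; uniqueness is `zpowGroupHom_units_injective`.
[cite: SpringerLAG1998, 3.2.2 and 3.2.11(i)] -/
theorem exists_unique_charPairing_holds : exists_unique_charPairing (T := T) := by
  intro _ χ γ hχ hγ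
  obtain ⟨p, hp⟩ := hχ
  obtain ⟨P, hP⟩ := hγ
  -- Step 1: `χ (γ x) = Q(x, x⁻¹)` with `Q = bind₁ P p`
  have hQ : ∀ x : kˣ, ((χ.comp γ x : kˣ) : k) =
      MvPolynomial.eval ![(x : k), (x⁻¹ : kˣ)] (MvPolynomial.bind₁ P p) := by
    intro x
    have hx : glCoordFun ((γ x : ↥T) : GL n k) =
        fun c => MvPolynomial.eval ![(x : k), (x⁻¹ : kˣ)] (P c) := funext (hP x)
    rw [eval_bind₁, MonoidHom.comp_apply, hp, hx]
  -- Step 2: clear denominators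
  obtain ⟨N, f, hf⟩ := exists_pow_mul_eval_eq_polynomial_eval (MvPolynomial.bind₁ P p)
  have hf' : ∀ x : kˣ, (x : k) ^ N * ((χ.comp γ x : kˣ) : k) = f.eval (x : k) := fun x => by
    rw [hQ, hf]
  -- Step 3: `f` is multiplicative on `kˣ` and non-zero
  have hmul : ∀ x y : kˣ, f.eval ((x : k) * y) = f.eval (x : k) * f.eval (y : k) := by
    intro x y
    rw [← Units.val_mul, ← hf', ← hf', ← hf', map_mul, Units.val_mul, Units.val_mul]
    ring
  have hf0 : f ≠ 0 := by
    intro h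
    have h1 := hf' 1
    rw [h, Polynomial.eval_zero, map_one, Units.val_one, one_pow, one_mul] at h1
    exact one_ne_zero h1
  -- Step 4: `f = X ^ d` on `kˣ`, so `χ ∘ γ = (· ^ (d - N))`
  have heq : χ.comp γ = zpowGroupHom ((f.natDegree : ℤ) - N) := by
    ext x : 1
    rw [zpowGroupHom_apply, zpow_sub, zpow_natCast, zpow_natCast, eq_mul_inv_iff_mul_eq]
    ext
    rw [Units.val_mul, Units.val_pow_eq_pow_val, Units.val_pow_eq_pow_val, mul_comm,
      hf', polynomial_eval_eq_pow_natDegree_of_map_mul hf0 hmul]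
  refine ⟨(f.natDegree : ℤ) - N, heq, fun m hm => ?_⟩
  exact zpowGroupHom_units_injective (hm.symm.trans heq)

/-- **Discharge** of `charPairingInt_spec`: for algebraic `χ, λ` over an infinite field,
`χ (λ x) = x ^ ⟨χ, λ⟩` (Springer 3.2.11 (i)); immediate from `exists_unique_charPairing_holds` and
the definition of `charPairingInt` by choice. [cite: SpringerLAG1998, 3.2.11(i)] -/
theorem charPairingInt_spec_holds : charPairingInt_spec (T := T) := by
  intro _ χ γ hχ hγ x
  obtain ⟨m, hm, -⟩ := exists_unique_charPairing_holds hχ hγ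
  have h : ∃ m : ℤ, χ.comp γ = zpowGroupHom m := ⟨m, hm⟩
  have hspec := h.choose_spec
  rw [charPairingInt, dif_pos h]
  exact DFunLike.congr_fun hspec x

end PairingHolds

section IsTorusSubgroupDiagonalHolds

/-- The diagonal subgroup `𝔻ₙ ≤ GL n k` is algebraic: it is cut out by the equations
`x i j = 0` for `i ≠ j` (Springer 2.1.4 (4)(b): `𝔻ₙ`, the group of non-singular diagonal matrices,
is a Zariski-closed subgroup of `GLₙ`). Holds over any field.
[cite: SpringerLAG1998, 2.1.4 (4)(b)] -/
theorem isAlgebraicSubgroup_diagonalSubgroup : IsAlgebraicSubgroup (diagonalSubgroup n k) := by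
  refine ⟨Set.range fun ij : {ij : n × n // ij.1 ≠ ij.2} =>
    (MvPolynomial.X (Sum.inl ij.1) : MvPolynomial (GLCoord n) k), ?_⟩
  ext g
  simp only [zeroLocusGL, Set.mem_setOf_eq, Set.forall_mem_range, MvPolynomial.eval_X,
    Subtype.forall, Prod.forall, glCoordFun_inl, SetLike.mem_coe]
  constructor
  · rintro ⟨d, rfl⟩ i j hij
    simp [Matrix.diagonal_apply_ne _ hij]
  · intro h
    have hdiag : (g : Matrix n n k) = Matrix.diagonal fun i => (g : Matrix n n k) i i := by
      ext i j
      by_cases hij : i = j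
      · subst hij; simp
      · rw [Matrix.diagonal_apply_ne _ hij, h i j hij]
    have hdet : (g : Matrix n n k).det ≠ 0 := Matrix.det_ne_zero_of_right_inverse g.mul_inv
    rw [hdiag, Matrix.det_diagonal, Finset.prod_ne_zero_iff] at hdet
    refine ⟨fun i => Units.mk0 ((g : Matrix n n k) i i) (hdet i (Finset.mem_univ i)),
      Units.ext ?_⟩
    rw [coe_diagonalGL]
    exact hdiag.symm

/-- The diagonal subgroup `𝔻ₙ ≤ GL n k` is commutative: it is the image of the commutative group
`(kˣ)ⁿ` under `diagonalGL` (Springer 3.2.1). [folklore] -/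
theorem isMulCommutative_diagonalSubgroup : IsMulCommutative ↥(diagonalSubgroup n k) := by
  unfold diagonalSubgroup
  infer_instance

/-- Over an algebraically closed field the diagonal subgroup `𝔻ₙ ≅ (kˣ)ⁿ` has no proper subgroup
of finite index: `(kˣ)ⁿ` is divisible (`m`-th roots exist, `IsAlgClosed.exists_pow_nat_eq`), and
the `m`-th power of every element lies in a normal subgroup of index `m` (`Subgroup.pow_index_mem`,
applied to the normal core of the given subgroup). This is the group-of-points shadow of the
connectedness of `𝔻ₙ` (Springer 2.2.1 (iii): a closed subgroup of finite index contains `G⁰`;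
2.2.2 (1): `𝔻ₙ` is connected); the closedness of `H` is not needed.
[cite: SpringerLAG1998, 2.2.1 (iii) and 2.2.2 (1)] -/
theorem eq_diagonalSubgroup_of_finiteIndex [IsAlgClosed k] {H : Subgroup (GL n k)}
    (hH : H ≤ diagonalSubgroup n k) (hfi : (H.subgroupOf (diagonalSubgroup n k)).FiniteIndex) :
    H = diagonalSubgroup n k := by
  refine le_antisymm hH ?_
  rintro _ ⟨d, rfl⟩
  set K : Subgroup ↥(diagonalSubgroup n k) := (H.subgroupOf (diagonalSubgroup n k)).normalCore
    with hK
  have hKfi : K.FiniteIndex := inferInstance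
  have hm : 0 < K.index := Nat.pos_of_ne_zero hKfi.index_ne_zero
  choose e he using fun i => IsAlgClosed.exists_pow_nat_eq (d i : k) hm
  have he0 : ∀ i, e i ≠ 0 := fun i h0 =>
    (d i).ne_zero (by rw [← he i, h0, zero_pow hm.ne'])
  set u : n → kˣ := fun i => Units.mk0 (e i) (he0 i) with hu
  have hud : u ^ K.index = d := by
    funext i
    ext
    simp [hu, he i]
  have hmem : (⟨diagonalGL n k u, u, rfl⟩ : ↥(diagonalSubgroup n k)) ^ K.index ∈ K :=
    K.pow_index_mem _
  have hmem' := Subgroup.mem_subgroupOf.mp ((Subgroup.normalCore_le _) hmem)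
  rwa [Subgroup.coe_pow, ← map_pow, hud] at hmem'

open Polynomial in
/-- A diagonal matrix is a semisimple element of `GL n k` (over any field): with `S` the finite set
of its diagonal entries, it is a root of the separable — hence squarefree — polynomial
`∏_{c ∈ S} (X - c)`, so `Module.End.isSemisimple_of_squarefree_aeval_eq_zero` applies
(Springer 2.4.1–2.4.2: diagonalizable endomorphisms are semisimple). [folklore] -/
theorem isSemisimpleElt_diagonalGL (d : n → kˣ) : IsSemisimpleElt (diagonalGL n k d) := by
  classical
  unfold IsSemisimpleElt
  set S : Finset k := Finset.univ.image fun i => (d i : k) with hS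
  refine Module.End.isSemisimple_of_squarefree_aeval_eq_zero (p := ∏ c ∈ S, (X - C c)) ?_ ?_
  · exact (Polynomial.separable_prod_X_sub_C_iff'.2 fun x _ y _ h => h).squarefree
  · have h1 : Matrix.toLin' (diagonalGL n k d : Matrix n n k) =
        Matrix.toLinAlgEquiv' (Matrix.diagonalAlgHom k fun i => (d i : k)) := rfl
    have h2 : aeval (fun i => (d i : k)) (∏ c ∈ S, (X - C c)) = 0 := by
      funext i
      rw [aeval_pi_apply₂, map_prod]
      exact Finset.prod_eq_zero (Finset.mem_image_of_mem _ (Finset.mem_univ i)) (by simp)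
    rw [h1, aeval_algHom_apply, aeval_algHom_apply, h2, map_zero, map_zero]

/-- The diagonal subgroup `𝔻ₙ ≤ GL n k` consists of semisimple elements (over any field).
[folklore] -/
theorem isSemisimpleElt_of_mem_diagonalSubgroup {g : GL n k} (hg : g ∈ diagonalSubgroup n k) :
    IsSemisimpleElt g := by
  obtain ⟨d, rfl⟩ := hg
  exact isSemisimpleElt_diagonalGL d

/-- Over an algebraically closed field the diagonal subgroup is Zariski-connected in the sense of
`IsZConnected` (Springer 2.2.2 (1) with 2.2.1 (iii)). [cite: SpringerLAG1998, 2.2.2 (1)] -/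
theorem isZConnected_diagonalSubgroup [IsAlgClosed k] : IsZConnected (diagonalSubgroup n k) :=
  ⟨isAlgebraicSubgroup_diagonalSubgroup, fun _ hH _ hfi =>
    eq_diagonalSubgroup_of_finiteIndex hH hfi⟩

/-- **Discharge** of `isTorusSubgroup_diagonal`: over an algebraically closed field the diagonal
subgroup `𝔻ₙ ≤ GL n k` is a torus in the sense of `IsTorusSubgroup` — Zariski-closed
(`isAlgebraicSubgroup_diagonalSubgroup`, Springer 2.1.4 (4)(b)) with no proper closed subgroup of
finite index (`eq_diagonalSubgroup_of_finiteIndex`, Springer 2.2.1 (iii), 2.2.2 (1)), commutative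
(`isMulCommutative_diagonalSubgroup`), and consisting of semisimple elements
(`isSemisimpleElt_diagonalGL`); Springer 3.2.1 defines a torus as a group isomorphic to some `𝔻ₙ`
(cf. 3.2.7 (ii)). [cite: SpringerLAG1998, 3.2.1 and 2.2.1] -/
theorem isTorusSubgroup_diagonal_holds : isTorusSubgroup_diagonal (k := k) (n := n) := by
  intro _
  exact ⟨isZConnected_diagonalSubgroup, isMulCommutative_diagonalSubgroup,
    fun _ hg => isSemisimpleElt_of_mem_diagonalSubgroup hg⟩

end IsTorusSubgroupDiagonalHolds

end Literature.NumberTheory.Automorphic
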